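import Mathlib
import Summits.QuantumAdvantage.QuantumAdvantage.Theorems.LinnikCubicClassGroupsPureCubicClassNumberHardHondaPrimeSetup
import Summits.QuantumAdvantage.QuantumAdvantage.Theorems.LinnikCubicClassGroupsPureCubicClassNumberHardStubUnitsNormOne9
import Summits.QuantumAdvantage.QuantumAdvantage.Theorems.LinnikCubicClassGroupsPureCubicClassNumberHardStubInvariantIdealsPrincipal
import Summits.QuantumAdvantage.QuantumAdvantage.Theorems.LinnikCubicClassGroupsPureCubicClassNumberHardStubClassNumberNotDvd
import HarnessLib

/-!
# Honda's criterion for a prime radicand, case `p ≡ 8 (mod 9)`: `3 ∤ h(ℚ(∛p))`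

Route `LinnikCubicClassGroups` (rank-0 hypothesis-type target `PureCubicClassNumberHard`,
stmt-QuantumAdvantage-11826); classical arithmetic of pure cubic fields around the booked
`pureCubicClassNumber_lowBits_mem_FBQP`.  T. Honda (*Pure cubic fields whose class numbers are
multiples of three*, J. Number Theory 3 (1971) 7–12, Theorem) determined when `3 ∣ h(ℚ(∛m))`;
for a PRIME radicand `p` the answer is: `3 ∣ h` iff `p ≡ 1 (mod 3)`.  The direction `p ≡ 1 (mod 3)
⟹ 3 ∣ h` is genus theory (tree: `Honda1971.three_dvd_classNumber_of_not_dvd_padicValNat`,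
Literature/…/PureCubicGenusDivisor.lean); this file proves the case `p ≡ 8 (mod 9)` of the
converse ([AouissiMayerIsmailiTalbiAzizi2020, Thm. 2.3 item (2)]: conductor `f = q₁ ≡ 8 (mod 9)`),
by Chevalley's ambiguous-class argument for `L = K(ζ₃)` over `F = ℚ(ζ₃)` with ONE ramified prime,
assembled from the tree's two-prime toolkit (`…StubUnitsNormOne9`, `…StubInvariantIdealsPrincipal`,
`…StubClassNumberNotDvd`, line `Sketch`/honda-leak of the same crux):

* `exists_three_normOne_units` — the unit Herbrand quotient (`MinkowskiUnit.card_mul_h0_unitsE_eq`,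
  Childress Prop. 5.10; `archFactor = 1` for totally complex `F`) gives `#Ĥ⁻¹(σ, 𝓞_Lˣ) = 3·#Ĥ⁰ ≥ 3`:
  three norm-one units pairwise inequivalent modulo `σ`-coboundaries, UNCONDITIONALLY;
* `exists_injective_cells` — with one ramified prime `P` (`P³ = (t)`, `t ∈ 𝓞_F`), inequivalent
  norm-one units `εᵢ = σ(yᵢ)/yᵢ` have pairwise distinct cells `eᵢ ∈ ℤ/3`, `(yᵢ) = (cᵢ)P^{eᵢ}`,
  and a cell `1` makes `P` principal;
* `invariantIdealsPrincipal_one` — hence every `σ`-invariant ideal is principal;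
* `exists_unit_norm_eq_of_one_ramified` — and a generator `u` of `𝓞_Fˣ` modulo cubes (here `ζ₃`)
  IS the norm of a unit of `L` (else `stub_unitsNormOne9` yields nine inequivalent units: nine
  cells in `ℤ/3`);
* `honda8` — **for a prime `p ≡ 8 (mod 9)` and every cubic number field `K ∋ ∛p`, `3 ∤ h(K)`**.

HONEST FRAMING (block-2b rule): a kernel-checked classical theorem on class numbers of pure cubic
fields, NOT summit progress; the crux `PureCubicClassNumberHard` is hypothesis-type and untouched.

## References
* T. Honda, *Pure cubic fields whose class numbers are multiples of three*, J. Number Theory 3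
  (1971) 7–12, Theorem. [Honda1971]
* S. Aouissi, D. C. Mayer, M. C. Ismaili, M. Talbi, A. Azizi, Period. Math. Hungar. 81 (2020),
  Thm. 2.3. [AouissiMayerIsmailiTalbiAzizi2020]
* P. Barrucand, H. Cohn, *A rational genus, class number divisibility, and unit theory for pure
  cubic fields*, J. Number Theory 2 (1970) 7–21. [BarrucandCohn1970]
* N. Childress, *Class Field Theory* (2009), Ch. 4 §5 Prop. 5.10. [Childress2009]
-/

set_option linter.dupNamespace false

noncomputable section

open NumberField

open scoped Pointwise NumberField IntermediateField

namespace Summit.QuantumAdvantage.QuantumAdvantage.Theorems.LinnikCubicClassGroups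

open Literature.NumberTheory.GaloisRepresentations
open Literature.NumberTheory.GaloisRepresentations.MinkowskiUnit
open Literature.NumberTheory.NumberFields

/-! ### Three norm-one units inequivalent modulo `σ`-coboundaries (unconditionally) -/

/-- **At least three norm-one units modulo coboundaries.**  For `L/F` cyclic cubic with generator
`σ` and `F` totally complex, `#Ĥ⁻¹(⟨σ⟩, 𝓞_Lˣ) = 3 · #Ĥ⁰(⟨σ⟩, 𝓞_Lˣ) ≥ 3` (the tree's unit
Herbrand quotient `MinkowskiUnit.card_mul_h0_unitsE_eq`, Childress Prop. 5.10, with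
`archFactor = 1`): there are three units of `L` of relative norm `1`, pairwise inequivalent modulo
`σ(η)/η`, `η ∈ 𝓞_Lˣ`. [folklore] -/
theorem exists_three_normOne_units
    (F L : Type) [Field F] [NumberField F] [Field L] [NumberField L] [Algebra F L]
    [IsGalois F L] (σ : L ≃ₐ[F] L) (hσ : ∀ τ : L ≃ₐ[F] L, τ ∈ Subgroup.zpowers σ)
    (hdeg : Module.finrank F L = 3) (hcx : ∀ v : NumberField.InfinitePlace F, v.IsComplex) :
    ∃ ε : Fin 3 → (𝓞 L)ˣ,
      (∀ i, Algebra.norm F (((ε i : 𝓞 L) : L)) = 1) ∧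
      ∀ i j, i ≠ j → ∀ η : (𝓞 L)ˣ,
        (((ε i : 𝓞 L) : L)) * ((η : 𝓞 L) : L) ≠ (((ε j : 𝓞 L) : L)) * σ ((η : 𝓞 L) : L) := by
  classical
  have hcard : Fintype.card (L ≃ₐ[F] L) = 3 := by
    rw [Fintype.card_eq_nat_card, IsGalois.card_aut_eq_finrank, hdeg]
  have harch : ArchHerbrand.archFactor F L = 1 := by
    refine Finset.prod_eq_one fun v _ => ?_
    have hw : (ArchHerbrand.placeOver L v).IsUnramified F := by
      rw [NumberField.InfinitePlace.isUnramified_iff]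
      refine Or.inr ?_
      rw [show (ArchHerbrand.placeOver L v).comap (algebraMap F L) = v from
        ArchHerbrand.isOver_placeOver v]
      exact hcx v
    exact NumberField.InfinitePlace.isUnramified_iff_card_stabilizer_eq_one.mp hw
  -- `#Ĥ⁻¹ = 3 · #Ĥ⁰ ≥ 3`
  have h1 : 3 ≤ Herbrand.h1 σ (unitsE L) ⊥ := by
    obtain ⟨hmain, hne⟩ := MinkowskiUnit.card_mul_h0_unitsE_eq (F := F) (E := L) hσ
    rw [hcard, harch, one_mul] at hmain
    omega
  obtain ⟨Z, hZ⟩ : ∃ Z : Subgroup (𝓞 L)ˣ, Z = (Herbrand.z1 (L ≃ₐ[F] L) (unitsE L) ⊥).comap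
      (Units.map (algebraMap (𝓞 L) L : 𝓞 L →* L)) := ⟨_, rfl⟩
  obtain ⟨B, hB⟩ : ∃ B : Subgroup (𝓞 L)ˣ, B = (Herbrand.b1 σ (unitsE L) ⊥).comap
      (Units.map (algebraMap (𝓞 L) L : 𝓞 L →* L)) := ⟨_, rfl⟩
  have hidx : Nat.card (Z ⧸ B.subgroupOf Z) = Herbrand.h1 σ (unitsE L) ⊥ := by
    rw [Herbrand.h1_def, ← Subgroup.index_eq_card]
    change B.relIndex Z = _
    rw [hB, Subgroup.relIndex_comap, hZ, Subgroup.map_comap_eq, show (Units.map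
        (algebraMap (𝓞 L) L : 𝓞 L →* L)).range = unitsE L from rfl, inf_eq_right.mpr Herbrand.z1_le]
  have hfin : Nat.card (Z ⧸ B.subgroupOf Z) ≠ 0 := by omega
  obtain ⟨e⟩ : Nonempty ((Z ⧸ B.subgroupOf Z) ≃ Fin (Nat.card (Z ⧸ B.subgroupOf Z))) :=
    ⟨Nat.equivFinOfCardPos hfin⟩
  have h3le : 3 ≤ Nat.card (Z ⧸ B.subgroupOf Z) := by rw [hidx]; exact h1
  -- an injection `Fin 3 → Z ⧸ B`
  let ι : Fin 3 → Z ⧸ B.subgroupOf Z := fun i => e.symm (Fin.castLE h3le i)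
  have hι : Function.Injective ι := fun i j h =>
    Fin.castLE_injective h3le (e.symm.injective h)
  obtain ⟨s, hs⟩ := (QuotientGroup.mk_surjective (s := B.subgroupOf Z)).hasRightInverse
  refine ⟨fun i => ((s (ι i) : Z) : (𝓞 L)ˣ), fun i => ?_, fun i j hij η heq => hij ?_⟩
  · have hmem := hZ.le (s (ι i)).2
    rw [Subgroup.mem_comap, Herbrand.mem_z1_bot] at hmem
    exact (herbrandNorm_eq_one_iff _).mp hmem.2
  · apply hι
    rw [← hs (ι i), ← hs (ι j), QuotientGroup.eq, Subgroup.mem_subgroupOf,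
      Subgroup.coe_mul, Subgroup.coe_inv]
    refine hB.ge ?_
    rw [Subgroup.mem_comap, map_mul, map_inv, Herbrand.b1_bot]
    refine ⟨(Units.map (algebraMap (𝓞 L) L : 𝓞 L →* L) η)⁻¹, (unitsE L).inv_mem ⟨η, rfl⟩, ?_⟩
    have hunits : Units.map (algebraMap (𝓞 L) L : 𝓞 L →* L) (s (ι i) : (𝓞 L)ˣ) *
          Units.map (algebraMap (𝓞 L) L : 𝓞 L →* L) η =
        Units.map (algebraMap (𝓞 L) L : 𝓞 L →* L) (s (ι j) : (𝓞 L)ˣ) *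
          (σ • Units.map (algebraMap (𝓞 L) L : 𝓞 L →* L) η) := by
      ext
      rw [Units.val_mul, Units.val_mul, val_smul, val_unitsMap, val_unitsMap, val_unitsMap]
      exact heq
    rw [map_inv, Herbrand.twist_apply, inv_div, div_eq_iff_eq_mul, mul_assoc,
      eq_inv_mul_iff_mul_eq]
    exact hunits

/-! ### One ramified prime: the cell map of inequivalent norm-one units -/

/-- **The cell map (one ramified prime).**  Let `L/F` be cyclic cubic with generator `σ`, `𝓞_F` a
PID, `P` a maximal ideal of `𝓞_L` with `P³ = (t)`, `t ∈ 𝓞_F`, carrying ALL the ramification of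
`L/F`.  Given norm-one units `ε₀, …, ε_{k−1}` pairwise inequivalent modulo `σ`-coboundaries of
units, write `εᵢ = σ(yᵢ)/yᵢ` (Hilbert 90) and `(yᵢ) = (cᵢ) P^{eᵢ}`, `eᵢ < 3` (structure of
invariant ideals); then `i ↦ eᵢ` is injective, and a value `eᵢ = 1` makes `P` principal.
[folklore] -/
theorem exists_injective_cells
    (F L : Type) [Field F] [NumberField F] [Field L] [NumberField L] [Algebra F L]
    [IsGalois F L] (σ : L ≃ₐ[F] L) (hσ : ∀ τ : L ≃ₐ[F] L, τ ∈ Subgroup.zpowers σ)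
    (hPID : IsPrincipalIdealRing (𝓞 F)) {P : Ideal (𝓞 L)} (hP : P.IsMaximal)
    {t : 𝓞 F} (ht : Ideal.span {algebraMap (𝓞 F) (𝓞 L) t} = P ^ 3)
    (hram : ∀ Q : Ideal (𝓞 L), Q.IsMaximal → Q.ramificationIdx (𝓞 F) ≠ 1 → Q = P)
    {k : ℕ} (ε : Fin k → (𝓞 L)ˣ) (hεN : ∀ i, Algebra.norm F (((ε i : 𝓞 L) : L)) = 1)
    (hεind : ∀ i j, i ≠ j → ∀ η : (𝓞 L)ˣ,
      (((ε i : 𝓞 L) : L)) * ((η : 𝓞 L) : L) ≠ (((ε j : 𝓞 L) : L)) * σ ((η : 𝓞 L) : L)) :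
    ∃ e : Fin k → Fin 3, Function.Injective e ∧ ∀ i, (e i : ℕ) = 1 → Submodule.IsPrincipal P := by
  classical
  have hram' : ∀ Q : Ideal (𝓞 L), Q.IsMaximal → Q.ramificationIdx (𝓞 F) ≠ 1 → Q = P ∨ Q = P :=
    fun Q hQ h => Or.inl (hram Q hQ h)
  have hstruct : ∀ J : Ideal (𝓞 L), J ≠ ⊥ → σ • J = J → ∃ (c : 𝓞 F) (e : ℕ), e < 3 ∧
      J = Ideal.span {algebraMap (𝓞 F) (𝓞 L) c} * P ^ e := by
    intro J hJ hJinv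
    obtain ⟨c, a, b, ha, hb, hJ'⟩ := exists_eq_span_mul_pow σ hσ hPID hP hP ht ht hram' J hJ hJinv
    refine ⟨c * t ^ ((a + b) / 3), (a + b) % 3, Nat.mod_lt _ (by norm_num), ?_⟩
    have hpow : P ^ a * P ^ b =
        Ideal.span {algebraMap (𝓞 F) (𝓞 L) (t ^ ((a + b) / 3))} * P ^ ((a + b) % 3) := by
      rw [← pow_add, map_pow, ← Ideal.span_singleton_pow, ht, ← pow_mul]
      conv_lhs => rw [← Nat.div_add_mod (a + b) 3, pow_add]
    rw [hJ', mul_assoc, hpow, map_mul, ← Ideal.span_singleton_mul_span_singleton]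
    ring
  -- Hilbert 90
  have hy : ∀ i, ∃ y : 𝓞 L, y ≠ 0 ∧ σ • y = (ε i : 𝓞 L) * y := fun i =>
    exists_smul_eq_mul_of_norm_eq_one σ hσ (hεN i)
  choose y hy0 hyσ using hy
  have hyinv : ∀ i, σ • Ideal.span {y i} = Ideal.span {y i} := by
    intro i
    rw [Ideal.smul_closure, Set.smul_set_singleton, hyσ]
    exact Ideal.span_singleton_mul_left_unit (ε i).isUnit (y i)
  have hdec : ∀ i, ∃ (c : 𝓞 F) (e : ℕ), e < 3 ∧
      Ideal.span {y i} = Ideal.span {algebraMap (𝓞 F) (𝓞 L) c} * P ^ e := fun i =>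
    hstruct _ (mt Ideal.span_singleton_eq_bot.mp (hy0 i)) (hyinv i)
  choose c e he hdec using hdec
  have hc0 : ∀ i, c i ≠ 0 := by
    intro i hci
    apply hy0 i
    have := hdec i
    rw [hci, map_zero] at this
    simpa using this
  refine ⟨fun i => ⟨e i, he i⟩, ?_, ?_⟩
  · intro i j hij
    simp only [Fin.mk.injEq] at hij
    by_contra hne
    have key : Ideal.span {y i * algebraMap (𝓞 F) (𝓞 L) (c j)} =
        Ideal.span {y j * algebraMap (𝓞 F) (𝓞 L) (c i)} := by
      rw [← Ideal.span_singleton_mul_span_singleton, ← Ideal.span_singleton_mul_span_singleton,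
        hdec i, hdec j, hij]
      ring
    obtain ⟨u, hu⟩ := Ideal.span_singleton_eq_span_singleton.mp key
    have hu' := congrArg (algebraMap (𝓞 L) L) hu
    rw [map_mul, map_mul, map_mul] at hu'
    have hσu := congrArg (fun x : 𝓞 L => algebraMap (𝓞 L) L (σ • x)) hu
    simp only [smul_mul', map_mul, hyσ, smul_algebraMap_ringOfIntegers] at hσu
    have hσu' : algebraMap (𝓞 L) L (σ • (u : 𝓞 L)) = σ (algebraMap (𝓞 L) L u) := rfl
    rw [hσu'] at hσu
    have h0 : algebraMap (𝓞 L) L (y i) * algebraMap (𝓞 L) L (algebraMap (𝓞 F) (𝓞 L) (c j)) ≠ 0 :=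
      mul_ne_zero (RingOfIntegers.coe_ne_zero_iff.mpr (hy0 i))
        (RingOfIntegers.coe_ne_zero_iff.mpr
          ((map_ne_zero_iff _ (RingOfIntegers.algebraMap.injective F L)).mpr (hc0 j)))
    have hfin : algebraMap (𝓞 L) L (y i) * algebraMap (𝓞 L) L (algebraMap (𝓞 F) (𝓞 L) (c j)) *
        (algebraMap (𝓞 L) L (ε i) * σ (algebraMap (𝓞 L) L u)) =
        algebraMap (𝓞 L) L (y i) * algebraMap (𝓞 L) L (algebraMap (𝓞 F) (𝓞 L) (c j)) *
        (algebraMap (𝓞 L) L (ε j) * algebraMap (𝓞 L) L u) := by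
      linear_combination hσu - algebraMap (𝓞 L) L (ε j) * hu'
    exact hεind j i (Ne.symm hne) u (mul_left_cancel₀ h0 hfin).symm
  · intro i hi
    have h := hdec i
    simp only at hi
    rw [hi, pow_one] at h
    exact isPrincipal_of_span_singleton_eq_mul h (hy0 i)

/-- **Invariant ideals are principal (one ramified prime).**  With the data of
`exists_injective_cells` and `F` totally complex, every nonzero `σ`-invariant ideal of `𝓞_L` is
principal: the three inequivalent norm-one units of `exists_three_normOne_units` fill the three
cells, so `P` is principal, and every invariant ideal is `(c) P^e`. [folklore] -/
theorem invariantIdealsPrincipal_one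
    (F L : Type) [Field F] [NumberField F] [Field L] [NumberField L] [Algebra F L]
    [IsGalois F L] (σ : L ≃ₐ[F] L) (hσ : ∀ τ : L ≃ₐ[F] L, τ ∈ Subgroup.zpowers σ)
    (hdeg : Module.finrank F L = 3) (hcx : ∀ v : NumberField.InfinitePlace F, v.IsComplex)
    (hPID : IsPrincipalIdealRing (𝓞 F)) {P : Ideal (𝓞 L)} (hP : P.IsMaximal)
    {t : 𝓞 F} (ht : Ideal.span {algebraMap (𝓞 F) (𝓞 L) t} = P ^ 3)
    (hram : ∀ Q : Ideal (𝓞 L), Q.IsMaximal → Q.ramificationIdx (𝓞 F) ≠ 1 → Q = P) :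
    ∀ I : Ideal (𝓞 L), I ≠ ⊥ → σ • I = I → Submodule.IsPrincipal I := by
  classical
  obtain ⟨ε, hεN, hεind⟩ := exists_three_normOne_units F L σ hσ hdeg hcx
  obtain ⟨e, hinj, hcell⟩ := exists_injective_cells F L σ hσ hPID hP ht hram ε hεN hεind
  have hsurj : Function.Surjective e :=
    ((Fintype.bijective_iff_injective_and_card _).mpr ⟨hinj, by simp⟩).2
  obtain ⟨i, hi⟩ := hsurj 1
  have hPpr : Submodule.IsPrincipal P := hcell i (by rw [hi]; rfl)
  intro I hI hinv
  have hram' : ∀ Q : Ideal (𝓞 L), Q.IsMaximal → Q.ramificationIdx (𝓞 F) ≠ 1 → Q = P ∨ Q = P :=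
    fun Q hQ h => Or.inl (hram Q hQ h)
  obtain ⟨c, a, b, -, -, hIeq⟩ := exists_eq_span_mul_pow σ hσ hPID hP hP ht ht hram' I hI hinv
  obtain ⟨z, hz⟩ := hPpr.principal
  rw [Ideal.submodule_span_eq] at hz
  rw [hIeq, hz, Ideal.span_singleton_pow, Ideal.span_singleton_pow,
    Ideal.span_singleton_mul_span_singleton, Ideal.span_singleton_mul_span_singleton]
  infer_instance

/-- **A generator of the units of `F` modulo cubes IS the norm of a unit (one ramified prime).**
With the data of `exists_injective_cells`, `F` totally complex and `u ∈ 𝓞_Fˣ` such that every unit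
of `F` is `uⁱ v³`: `u` is the relative norm of a unit of `L`.  (Otherwise the tree's
`stub_unitsNormOne9` gives nine norm-one units pairwise inequivalent modulo coboundaries, whose
cells would embed `Fin 9 ↪ Fin 3`.) [folklore] -/
theorem exists_unit_norm_eq_of_one_ramified
    (F L : Type) [Field F] [NumberField F] [Field L] [NumberField L] [Algebra F L]
    [IsGalois F L] (σ : L ≃ₐ[F] L) (hσ : ∀ τ : L ≃ₐ[F] L, τ ∈ Subgroup.zpowers σ)
    (hdeg : Module.finrank F L = 3) (hcx : ∀ v : NumberField.InfinitePlace F, v.IsComplex)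
    (hPID : IsPrincipalIdealRing (𝓞 F)) {P : Ideal (𝓞 L)} (hP : P.IsMaximal)
    {t : 𝓞 F} (ht : Ideal.span {algebraMap (𝓞 F) (𝓞 L) t} = P ^ 3)
    (hram : ∀ Q : Ideal (𝓞 L), Q.IsMaximal → Q.ramificationIdx (𝓞 F) ≠ 1 → Q = P)
    (u : (𝓞 F)ˣ) (hgen : ∀ w : (𝓞 F)ˣ, ∃ i : ℕ, ∃ v : (𝓞 F)ˣ, w = u ^ i * v ^ 3) :
    ∃ ε : (𝓞 L)ˣ, Algebra.norm F (((ε : 𝓞 L) : L)) = ((u : 𝓞 F) : F) := by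
  classical
  by_contra hnot
  push Not at hnot
  obtain ⟨ε, hεN, hεind⟩ := stub_unitsNormOne9 F L σ hσ hdeg hcx u hnot hgen
  obtain ⟨e, hinj, -⟩ := exists_injective_cells F L σ hσ hPID hP ht hram ε hεN hεind
  have := Fintype.card_le_of_injective e hinj
  simp at this


/-! ### Honda's criterion for a prime radicand `p ≡ 8 (mod 9)` -/

/-- **Honda's criterion, case `m = p ≡ 8 (mod 9)`** (T. Honda, J. Number Theory 3 (1971), Theorem;
[AouissiMayerIsmailiTalbiAzizi2020, Thm. 2.3 item (2)]: conductor `f = q₁ ≡ 8 (mod 9)`): for a prime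
`p ≡ 8 (mod 9)` and every cubic number field `K ∋ ∛p`, `3 ∤ h_K`.  Proof (Chevalley's ambiguous
classes for `L = K(ζ₃)` over `F = ℚ(ζ₃)`, generator `σ`): the only prime of `L` ramified over `F` is
the prime `P` above the inert `p` (`p ≡ ±1 (mod 9)` keeps `λ = 1 − ζ₃` unramified, Hecke), `P³ = (p)`;
the unit Herbrand quotient gives `≥ 3` norm-one units modulo coboundaries, whose `σ`-invariant
principal ideals `(yᵢ) = (cᵢ)P^{eᵢ}` occupy all three cells `eᵢ ∈ ℤ/3`, so `P` — hence every
invariant ideal — is principal; and `ζ₃` is the norm of a UNIT of `L` (nine inequivalent norm-one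
units, which its failure would produce, do not fit into three cells), so every element of `L` whose
norm is a unit of `F` has the norm of a unit; therefore every `σ`-invariant class of `Cl(L)` is trivial,
`3 ∤ h_L` (a `3`-cycle on `Cl(L)` with one fixed point), and `3 ∤ h_K` since `3 ∣ h_K ⟹ 3 ∣ h_L`
(`[L:K] = 2`). [cite: Honda1971, Theorem] [cite: AouissiMayerIsmailiTalbiAzizi2020, Thm. 2.3 item (2)] -/
theorem honda8 (p : ℕ) (hp : p.Prime) (hp9 : p % 9 = 8)
    (K : Type) [Field K] [NumberField K] (hK : Module.finrank ℚ K = 3)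
    (hα : ∃ α : K, α ^ 3 = (p : K)) : ¬ 3 ∣ classNumber K := by
  classical
  intro h3K
  obtain ⟨α, hα⟩ := hα
  have hp3 : p % 3 = 2 := by omega
  obtain ⟨hKL, hL6, hGal, F, hgal, hFL, hF2, ⟨σ, hσ⟩, hPID, hcplx, ⟨θ, hθ, hθdeg⟩, ζ, hζ3, hζ1,
    hζeq, hunits, P, hP, hpP, hspan, heP, h3P, hcardP⟩ :=
    fieldSetup_prime hp hp3 K hK hα (CyclotomicField 3 K)
  haveI := hgal
  haveI := hGal
  have h3L : 3 ∣ classNumber (CyclotomicField 3 K) :=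
    Honda1971.dvd_classNumber_of_dvd_classNumber_of_not_dvd_finrank
      (K := K) (L := CyclotomicField 3 K) Nat.prime_three h3K (by rw [hKL]; norm_num)
  -- the ramification census: `P` is the only prime of `L` ramified over `F`
  have hcensus : ∀ Q : Ideal (𝓞 (CyclotomicField 3 K)), Q.IsMaximal →
      Q.ramificationIdx (𝓞 F) ≠ 1 → Q = P := by
    intro Q hQ hram
    by_contra hQP
    have hpQ : (p : 𝓞 (CyclotomicField 3 K)) ∉ Q := by
      intro hpQ
      have hle : P ^ 3 ≤ Q := by
        rw [← hspan, Ideal.span_singleton_le_iff_mem]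
        exact hpQ
      have hPQ : P ≤ Q :=
        (Ideal.IsPrime.pow_le_iff (I := P) (hP := hQ.isPrime) (by norm_num)).mp hle
      exact hQP (hP.eq_of_le hQ.ne_top hPQ).symm
    haveI := hQ
    have hunr : Algebra.IsUnramifiedAt (𝓞 F) Q :=
      Honda1971.isUnramifiedAt_of_natCast_notMem F hF2 hFL hζeq (p := p) (q := 1)
        (by rw [Nat.mul_one]; exact Or.inr hp9) (β := θ) (by rw [Nat.mul_one]; exact hθ) hθdeg Q
        (by rw [Nat.mul_one]; exact hpQ)
    exact hram (Ideal.ramificationIdx_eq_one_iff.mpr hunr)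
  have ht : Ideal.span {algebraMap (𝓞 F) (𝓞 (CyclotomicField 3 K)) (p : 𝓞 F)} = P ^ 3 := by
    simpa using hspan
  -- every `σ`-invariant ideal is principal
  have hprinc : ∀ I : Ideal (𝓞 (CyclotomicField 3 K)), I ≠ ⊥ → σ • I = I →
      Submodule.IsPrincipal I :=
    invariantIdealsPrincipal_one F (CyclotomicField 3 K) σ hσ hFL hcplx hPID hP ht hcensus
  -- `ζ₃` is the norm of a unit of `L`
  have hgen : ∀ w : (𝓞 F)ˣ, ∃ i : ℕ, ∃ v : (𝓞 F)ˣ, w = ζ ^ i * v ^ 3 := by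
    intro w
    obtain ⟨i, hi | hi⟩ := hunits w
    · exact ⟨i, 1, by rw [hi]; simp⟩
    · exact ⟨i, -1, by rw [hi]; norm_num⟩
  obtain ⟨ε₀, hε₀⟩ :=
    exists_unit_norm_eq_of_one_ramified F (CyclotomicField 3 K) σ hσ hFL hcplx hPID hP ht hcensus
      ζ hgen
  -- hence every element whose norm is a unit of `F` has the norm of a unit of `L`
  set z : F := ((ζ : 𝓞 F) : F) with hz
  have hzpow : ∀ n : ℕ, (((ζ ^ n : (𝓞 F)ˣ) : 𝓞 F) : F) = z ^ n := by
    intro n; simp [hz]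
  have hzneg : ∀ n : ℕ, (((-ζ ^ n : (𝓞 F)ˣ) : 𝓞 F) : F) = -z ^ n := by
    intro n; simp [hz]
  have hεpow : ∀ n : ℕ, Algebra.norm F ((((ε₀ ^ n : (𝓞 (CyclotomicField 3 K))ˣ) :
      𝓞 (CyclotomicField 3 K)) : CyclotomicField 3 K)) = z ^ n := by
    intro n
    have : ((((ε₀ ^ n : (𝓞 (CyclotomicField 3 K))ˣ) : 𝓞 (CyclotomicField 3 K)) :
        CyclotomicField 3 K)) = (((ε₀ : 𝓞 (CyclotomicField 3 K)) : CyclotomicField 3 K)) ^ n := by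
      simp
    rw [this, map_pow, hε₀]
  have hεneg : ∀ n : ℕ, Algebra.norm F ((((-ε₀ ^ n : (𝓞 (CyclotomicField 3 K))ˣ) :
      𝓞 (CyclotomicField 3 K)) : CyclotomicField 3 K)) = -z ^ n := by
    intro n
    have : ((((-ε₀ ^ n : (𝓞 (CyclotomicField 3 K))ˣ) : 𝓞 (CyclotomicField 3 K)) :
        CyclotomicField 3 K)) =
        algebraMap F (CyclotomicField 3 K) (-1) *
          (((ε₀ : 𝓞 (CyclotomicField 3 K)) : CyclotomicField 3 K)) ^ n := by
      simp
    rw [this, map_mul, Algebra.norm_algebraMap, hFL, map_pow, hε₀]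
    ring
  have hN : ∀ x : CyclotomicField 3 K, (∃ u : (𝓞 F)ˣ, Algebra.norm F x = ((u : 𝓞 F) : F)) →
      ∃ ε : (𝓞 (CyclotomicField 3 K))ˣ,
        Algebra.norm F (((ε : 𝓞 (CyclotomicField 3 K)) : CyclotomicField 3 K)) =
          Algebra.norm F x := by
    rintro x ⟨u, hu⟩
    obtain ⟨i, hi | hi⟩ := hunits u
    · exact ⟨ε₀ ^ i, by rw [hεpow, hu, hi, hzpow]⟩
    · exact ⟨-ε₀ ^ i, by rw [hεneg, hu, hi, hzneg]⟩
  exact stub_classNumber_not_dvd F (CyclotomicField 3 K) σ hσ hFL hN hprinc h3L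

end Summit.QuantumAdvantage.QuantumAdvantage.Theorems.LinnikCubicClassGroups

end
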